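import Literature.AlgebraicGeometry.HodgeTheory.BlochSemiregularSpreadOfSubscheme
import Literature.AlgebraicGeometry.HodgeTheory.BlochSemiregularSpreadGlobal
import HarnessLib

/-!
# Bloch's semiregularity theorem for an arbitrary local complete intersection subscheme, global form:
# the class is algebraic on the WHOLE irreducible base (Bloch 1972, Thm. (7.4), last paragraph of its
# proof, and Remark (7.5)) — proved from the tree's named facts

Family `hodge`, layer `Literature/AlgebraicGeometry/HodgeTheory`. THEOREMS ONLY (no definition, no new
named fact; D-0026). Companion of `BlochSemiregularSpreadOfSubscheme.lean` (the NAMED FACT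
`BlochSemiregularSpreadOfSubscheme n p`: Bloch (7.4) = Buchweitz–Flenner Thm. 5.2 at `I = {p}` for an
arbitrary local complete intersection closed subscheme `Z ↪ X₀ ≅ 𝒳_{s₀}` of codimension `p`, class
`x = [Z]` the fundamental class of the subscheme, conclusion on an open neighbourhood of `s₀`) in the
way `BlochSemiregularSpreadGlobal.lean` is the companion of `BlochSemiregularSpread.lean`: Bloch's last
paragraph ("`T = {s ∈ S | z_s is algebraic}` is contained in a countable union of closed subvarieties of
`S`. Since `U ⊂ T`, it follows that `T = S`") is the tree's
`charlesSchnell_algebraicityLocus_iUnion_closed.forall_mem_algebraicClasses_of_isOpen` (algebraic on a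
non-empty analytic-open subset of `S(ℂ)`, `S` irreducible ⇒ algebraic at every `t ∈ S(ℂ)`), granted the
named fact `charlesSchnell_algebraicityLocus_iUnion_closed` (`AlgebraicityLocus.lean`). Written for the
cell `pub-hsemireg` (reducible semiregular seeds such as Schoen's `Δ ∪ (C × C)`; Lean door table of
seat p3, "GAP 2").

## Source, verbatim (S. Bloch, *Semi-regularity and de Rham cohomology*, Invent. Math. 17 (1972)
## 51–66, p. 65; open GDZ digitisation, page images read by the cell 2026-08-22)

"**(7.4) Theorem.** Let `X →ᶠ S →ᵍ Spec(ℂ)` be morphisms, with `f` smooth and projective and `g`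
smooth, connected, and of finite type. Let `z ∈ Γ(S, R^{2p} f_*(Ω•_{X/S}))` be a horizontal section and
let `o ∈ S`. Suppose the restricted class `z₀ ∈ H^{2p}_{DR}(X₀/ℂ)` is algebraic, representing a local
complete intersection, `Z₀ ⊂ X₀` which is semi-regular in `X₀`. Then for all `s ∈ S`,
`z_s ∈ H^{2p}_{DR}(X_s/ℂ)` is algebraic." Proof, last paragraph: "Hence `Z₀` lifts to an analytic
family over `U`, so `z_s` is algebraic for `s ∈ U`. A simple argument using the Hilbert scheme shows
`T = {s ∈ S | z_s is algebraic}` is contained in a countable union of closed subvarieties of `S`. Since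
`U ⊂ T`, it follows that `T = S`, proving (7.4)." "(7.5) Remark. … The hypothesis on `z₀` in (7.4) can
be weakened to read: there exist integers `a, b`, `a ≠ 0`, such that `a z₀ + b l₀^p` is the class of a
subscheme `Z₀ ⊂ X₀` which is semi-regular and a local complete intersection."

## What is proved

* `BlochSemiregularSpreadOfSubscheme.forall_mem_algebraicClasses` — granted the fact and the
  algebraicity-locus fact, under the hypotheses of `BlochSemiregularSpreadOfSubscheme` with `S`
  irreducible ("`g` smooth, connected"), `W|_{𝒳_t}` is algebraic for ALL `t ∈ S(ℂ)`.
* `BlochSemiregularSpreadOfSubscheme.forall_mem_algebraicClasses_of_smul_add` — the same under Remark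
  (7.5)'s weakened class hypothesis `a·W|_{𝒳_{s₀}} + b·L|_{𝒳_{s₀}} = [Z]`, `a ≠ 0`, `L` fibrewise
  rational `(p,p)` and fibrewise algebraic (from the proved local form
  `BlochSemiregularSpreadOfSubscheme.of_smul_add`).
* `BlochSemiregularSpreadOfSubscheme.of_rat_smul_add` and
  `BlochSemiregularSpreadOfSubscheme.forall_mem_algebraicClasses_of_rat_smul_add` — the same two
  statements with RATIONAL coefficients `a, b ∈ ℚ`, `a ≠ 0` (an immediate consequence of the fact,
  "algebraic" being a `ℚ`-linear condition; this is the shape in which the cell's certificates arrive,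
  e.g. `h² + w = 6·([Δ] + [C × C])` on `J(C) × J(C)`).

## References

* [Bloch1972Semiregularity] S. Bloch, Semi-regularity and de Rham cohomology, Invent. Math. 17 (1972)
  51–66: Thm. (7.4) (p. 65), the last paragraph of its proof, Remark (7.5).
* [BuchweitzFlenner2003] R.-O. Buchweitz, H. Flenner, A semiregularity map for modules and applications
  to deformations, Compositio Math. 137 (2003) 135–210: Thm. 5.2 (p. 175).
* [CharlesSchnell2014Notes] F. Charles, C. Schnell, Notes on absolute Hodge classes, proof of
  Prop. 11.3.11.
-/

noncomputable section

open CategoryTheory AlgebraicGeometry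

namespace Literature.AlgebraicGeometry.HodgeTheory

section Global

open Literature.AlgebraicGeometry.Motives

variable {n p : ℕ} {𝒳 S : SchemeOver ℂ}

local notation3 (prettyPrint := false) "Res[" f ", " s ", " k ", " A "]" =>
  complexBetti.map (Motives.fiberι f s) k A

/-- **Bloch 1972, Thm. (7.4) for an arbitrary local complete intersection subscheme — class level,
GLOBAL over an irreducible base** ("Then for all `s ∈ S`, `z_s ∈ H^{2p}_{DR}(X_s/ℂ)` is algebraic";
proof, last paragraph: "`T = {s ∈ S | z_s is algebraic}` is contained in a countable union of closed
subvarieties of `S`. Since `U ⊂ T`, it follows that `T = S`"). Granted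
`BlochSemiregularSpreadOfSubscheme n p` and the tree's algebraicity-locus fact
`charlesSchnell_algebraicityLocus_iUnion_closed`, under the hypotheses of the fact (a Bloch-semiregular
local complete intersection `Z ↪ X₀ ≅ 𝒳_{s₀}` of codimension `p`, `x = [Z]` its fundamental class, a
global class `W` fibrewise rational of type `(p,p)` restricting to `x` at `s₀`) with `S` irreducible
(Bloch's "`g` smooth, connected"), `W|_{𝒳_t}` is algebraic for EVERY `t ∈ S(ℂ)`
(`charlesSchnell_algebraicityLocus_iUnion_closed.forall_mem_algebraicClasses_of_isOpen`).
[cite: Bloch1972Semiregularity, Thm. (7.4) (p. 65) and the last paragraph of its proof]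
[cite: BuchweitzFlenner2003, Thm. 5.2 (p. 175)]
[cite: CharlesSchnell2014Notes, Prop. 11.3.11 (proof)] -/
theorem BlochSemiregularSpreadOfSubscheme.forall_mem_algebraicClasses
    (h : BlochSemiregularSpreadOfSubscheme n p) (hCS : charlesSchnell_algebraicityLocus_iUnion_closed)
    (X₀ : SchemeOver ℂ) (Z : Scheme.{0}) (i : Z ⟶ X₀.left) [IsLocallyNoetherian Z]
    (x : complexBetti X₀ (2 * p))
    (f : 𝒳 ⟶ S) (s₀ : ComplexPoints S) (e : X₀ ≅ fiberOver f s₀) (W : complexBetti 𝒳 (2 * p))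
    (hX₀ : IsSmoothProjective n X₀) (d : ℕ) (hdp : d + p = n) (ρ : ResolutionFamily X₀ d)
    (hi : IsClosedImmersion i) (hreg : IsRegularImmersionOfCodim i p)
    (hcodim : ∀ z ∈ Set.range i.base, (p : ℕ∞) ≤ Order.coheight z) (hsr : IsBlochSemiregular i n p)
    (hmem : subschemeCycle i hi ∈ cyclesOfDim X₀.left d) (hxZ : x = subschemeClass hX₀ hdp ρ i hi)
    (hf : IsSmoothProjectiveFamily f n) (h𝒳 : IsQuasiProjectiveOver 𝒳) (hS : IsQuasiProjectiveOver S)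
    (hSm : _root_.AlgebraicGeometry.Smooth S.hom) [IrreducibleSpace S.left]
    (hW : ∀ s : ComplexPoints S, IsRationalClass (Res[f, s, 2 * p, W]) ∧
      IsOfHodgeType n (fiberOver f s) (2 * p) p p (Res[f, s, 2 * p, W]))
    (hWx : complexBetti.map e.hom (2 * p) (Res[f, s₀, 2 * p, W]) = x) (t : ComplexPoints S) :
    Res[f, t, 2 * p, W] ∈ algebraicClasses (fiberOver f t) p := by
  obtain ⟨U, hU, hs₀, hUA⟩ :=
    h X₀ Z i x 𝒳 S f s₀ e W hX₀ d hdp ρ hi hreg hcodim hsr hmem hxZ hf h𝒳 hS hSm hW hWx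
  exact hCS.forall_mem_algebraicClasses_of_isOpen f n p h𝒳 hS hSm hf W hU ⟨s₀, hs₀⟩ hUA t

/-- **Remark (7.5), GLOBAL over an irreducible base**: granted the fact and the algebraicity-locus
fact, if `a·W|_{𝒳_{s₀}} + b·L|_{𝒳_{s₀}} = [Z]` read through `e : X₀ ≅ 𝒳_{s₀}` (`a ≠ 0`; `L` a global
class fibrewise rational of type `(p,p)` and fibrewise algebraic, e.g. the `p`-th power of the
polarization class) for a Bloch-semiregular local complete intersection `Z ↪ X₀` of codimension `p`,
then `W|_{𝒳_t}` is algebraic for every `t ∈ S(ℂ)` (`BlochSemiregularSpreadOfSubscheme.of_smul_add` and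
Bloch's last paragraph). [cite: Bloch1972Semiregularity, Thm. (7.4) and Remark (7.5) (p. 65)]
[cite: CharlesSchnell2014Notes, Prop. 11.3.11 (proof)] -/
theorem BlochSemiregularSpreadOfSubscheme.forall_mem_algebraicClasses_of_smul_add
    (h : BlochSemiregularSpreadOfSubscheme n p) (hCS : charlesSchnell_algebraicityLocus_iUnion_closed)
    (X₀ : SchemeOver ℂ) (Z : Scheme.{0}) (i : Z ⟶ X₀.left) [IsLocallyNoetherian Z]
    (f : 𝒳 ⟶ S) (s₀ : ComplexPoints S) (e : X₀ ≅ fiberOver f s₀) (W L : complexBetti 𝒳 (2 * p))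
    (a b : ℤ) (ha : a ≠ 0)
    (hX₀ : IsSmoothProjective n X₀) (d : ℕ) (hdp : d + p = n) (ρ : ResolutionFamily X₀ d)
    (hi : IsClosedImmersion i) (hreg : IsRegularImmersionOfCodim i p)
    (hcodim : ∀ z ∈ Set.range i.base, (p : ℕ∞) ≤ Order.coheight z) (hsr : IsBlochSemiregular i n p)
    (hmem : subschemeCycle i hi ∈ cyclesOfDim X₀.left d)
    (hf : IsSmoothProjectiveFamily f n) (h𝒳 : IsQuasiProjectiveOver 𝒳) (hS : IsQuasiProjectiveOver S)
    (hSm : _root_.AlgebraicGeometry.Smooth S.hom) [IrreducibleSpace S.left]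
    (hW : ∀ s : ComplexPoints S, IsRationalClass (Res[f, s, 2 * p, W]) ∧
      IsOfHodgeType n (fiberOver f s) (2 * p) p p (Res[f, s, 2 * p, W]))
    (hL : ∀ s : ComplexPoints S, IsRationalClass (Res[f, s, 2 * p, L]) ∧
      IsOfHodgeType n (fiberOver f s) (2 * p) p p (Res[f, s, 2 * p, L]))
    (hLalg : ∀ t : ComplexPoints S, Res[f, t, 2 * p, L] ∈ algebraicClasses (fiberOver f t) p)
    (hx : (a : ℂ) • complexBetti.map e.hom (2 * p) (Res[f, s₀, 2 * p, W]) +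
        (b : ℂ) • complexBetti.map e.hom (2 * p) (Res[f, s₀, 2 * p, L]) =
      subschemeClass hX₀ hdp ρ i hi) (t : ComplexPoints S) :
    Res[f, t, 2 * p, W] ∈ algebraicClasses (fiberOver f t) p := by
  obtain ⟨U, hU, hs₀, hUA⟩ := h.of_smul_add X₀ Z i f s₀ e W L a b ha hX₀ d hdp ρ hi hreg hcodim hsr
    hmem hf h𝒳 hS hSm hW hL hLalg hx
  exact hCS.forall_mem_algebraicClasses_of_isOpen f n p h𝒳 hS hSm hf W hU ⟨s₀, hs₀⟩ hUA t

/-- **Remark (7.5) with rational coefficients** (proved from the fact): if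
`a·W|_{𝒳_{s₀}} + b·L|_{𝒳_{s₀}} = [Z]` read through `e : X₀ ≅ 𝒳_{s₀}` with `a, b ∈ ℚ`, `a ≠ 0`, `L` a
global class fibrewise rational of type `(p,p)` and fibrewise algebraic, for a Bloch-semiregular local
complete intersection `Z ↪ X₀` of codimension `p`, then `W|_{𝒳_t}` is algebraic for all `t` near `s₀`:
apply the fact to the horizontal section `a·W + b·L` (value `[Z]` at `s₀`), subtract `b·L|_{𝒳_t}` and
divide by `a` in the `ℂ`-subspace `algebraicClasses (𝒳_t) p` (Bloch prints `a, b ∈ ℤ`; over `ℚ` the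
statement is the same consequence of (7.4)). [cite: Bloch1972Semiregularity, Remark (7.5) (p. 65)] -/
theorem BlochSemiregularSpreadOfSubscheme.of_rat_smul_add (h : BlochSemiregularSpreadOfSubscheme n p)
    (X₀ : SchemeOver ℂ) (Z : Scheme.{0}) (i : Z ⟶ X₀.left) [IsLocallyNoetherian Z]
    (f : 𝒳 ⟶ S) (s₀ : ComplexPoints S) (e : X₀ ≅ fiberOver f s₀) (W L : complexBetti 𝒳 (2 * p))
    (a b : ℚ) (ha : a ≠ 0)
    (hX₀ : IsSmoothProjective n X₀) (d : ℕ) (hdp : d + p = n) (ρ : ResolutionFamily X₀ d)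
    (hi : IsClosedImmersion i) (hreg : IsRegularImmersionOfCodim i p)
    (hcodim : ∀ z ∈ Set.range i.base, (p : ℕ∞) ≤ Order.coheight z) (hsr : IsBlochSemiregular i n p)
    (hmem : subschemeCycle i hi ∈ cyclesOfDim X₀.left d)
    (hf : IsSmoothProjectiveFamily f n) (h𝒳 : IsQuasiProjectiveOver 𝒳) (hS : IsQuasiProjectiveOver S)
    (hSm : _root_.AlgebraicGeometry.Smooth S.hom)
    (hW : ∀ s : ComplexPoints S, IsRationalClass (Res[f, s, 2 * p, W]) ∧
      IsOfHodgeType n (fiberOver f s) (2 * p) p p (Res[f, s, 2 * p, W]))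
    (hL : ∀ s : ComplexPoints S, IsRationalClass (Res[f, s, 2 * p, L]) ∧
      IsOfHodgeType n (fiberOver f s) (2 * p) p p (Res[f, s, 2 * p, L]))
    (hLalg : ∀ t : ComplexPoints S, Res[f, t, 2 * p, L] ∈ algebraicClasses (fiberOver f t) p)
    (hx : ((a : ℚ) : ℂ) • complexBetti.map e.hom (2 * p) (Res[f, s₀, 2 * p, W]) +
        ((b : ℚ) : ℂ) • complexBetti.map e.hom (2 * p) (Res[f, s₀, 2 * p, L]) =
      subschemeClass hX₀ hdp ρ i hi) :
    ∃ U : Set (ComplexPoints S), IsOpen U ∧ s₀ ∈ U ∧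
      ∀ t ∈ U, Res[f, t, 2 * p, W] ∈ algebraicClasses (fiberOver f t) p := by
  -- the horizontal section `a·W + b·L`
  set W' : complexBetti 𝒳 (2 * p) := ((a : ℚ) : ℂ) • W + ((b : ℚ) : ℂ) • L with hW'def
  have hres : ∀ s : ComplexPoints S, Res[f, s, 2 * p, W'] =
      ((a : ℚ) : ℂ) • Res[f, s, 2 * p, W] + ((b : ℚ) : ℂ) • Res[f, s, 2 * p, L] := by
    intro s
    rw [hW'def, map_add, map_smul, map_smul]
  have hW' : ∀ s : ComplexPoints S, IsRationalClass (Res[f, s, 2 * p, W']) ∧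
      IsOfHodgeType n (fiberOver f s) (2 * p) p p (Res[f, s, 2 * p, W']) := by
    intro s
    rw [hres]
    exact ⟨((hW s).1.smul a).add ((hL s).1.smul b),
      ((hW s).2.smul _).add (hf.isSmoothProjective s) ((hL s).2.smul _)⟩
  have hx' : complexBetti.map e.hom (2 * p) (Res[f, s₀, 2 * p, W']) =
      subschemeClass hX₀ hdp ρ i hi := by
    rw [hres, map_add, map_smul, map_smul]
    exact hx
  obtain ⟨U, hU, hs₀, hUA⟩ :=
    h X₀ Z i _ 𝒳 S f s₀ e W' hX₀ d hdp ρ hi hreg hcodim hsr hmem rfl hf h𝒳 hS hSm hW' hx'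
  refine ⟨U, hU, hs₀, fun t ht ↦ ?_⟩
  have h1 : ((a : ℚ) : ℂ) • Res[f, t, 2 * p, W] + ((b : ℚ) : ℂ) • Res[f, t, 2 * p, L] ∈
      algebraicClasses (fiberOver f t) p := by
    rw [← hres]
    exact hUA t ht
  have h2 : ((a : ℚ) : ℂ) • Res[f, t, 2 * p, W] ∈ algebraicClasses (fiberOver f t) p := by
    have h3 := Submodule.sub_mem _ h1 (Submodule.smul_mem _ ((b : ℚ) : ℂ) (hLalg t))
    rwa [add_sub_cancel_right] at h3
  have ha' : ((a : ℚ) : ℂ) ≠ 0 := Rat.cast_ne_zero.2 ha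
  have h4 := Submodule.smul_mem _ ((a : ℚ) : ℂ)⁻¹ h2
  rwa [smul_smul, inv_mul_cancel₀ ha', one_smul] at h4

/-- **Remark (7.5) with rational coefficients, GLOBAL over an irreducible base** (proved from the two
facts): `a·W|_{𝒳_{s₀}} + b·L|_{𝒳_{s₀}} = [Z]`, `a, b ∈ ℚ`, `a ≠ 0`, `Z` a Bloch-semiregular local
complete intersection of codimension `p`, `L` fibrewise rational `(p,p)` and fibrewise algebraic, `S`
irreducible ⇒ `W|_{𝒳_t}` is algebraic for every `t ∈ S(ℂ)`.
[cite: Bloch1972Semiregularity, Thm. (7.4) and Remark (7.5) (p. 65)]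
[cite: CharlesSchnell2014Notes, Prop. 11.3.11 (proof)] -/
theorem BlochSemiregularSpreadOfSubscheme.forall_mem_algebraicClasses_of_rat_smul_add
    (h : BlochSemiregularSpreadOfSubscheme n p) (hCS : charlesSchnell_algebraicityLocus_iUnion_closed)
    (X₀ : SchemeOver ℂ) (Z : Scheme.{0}) (i : Z ⟶ X₀.left) [IsLocallyNoetherian Z]
    (f : 𝒳 ⟶ S) (s₀ : ComplexPoints S) (e : X₀ ≅ fiberOver f s₀) (W L : complexBetti 𝒳 (2 * p))
    (a b : ℚ) (ha : a ≠ 0)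
    (hX₀ : IsSmoothProjective n X₀) (d : ℕ) (hdp : d + p = n) (ρ : ResolutionFamily X₀ d)
    (hi : IsClosedImmersion i) (hreg : IsRegularImmersionOfCodim i p)
    (hcodim : ∀ z ∈ Set.range i.base, (p : ℕ∞) ≤ Order.coheight z) (hsr : IsBlochSemiregular i n p)
    (hmem : subschemeCycle i hi ∈ cyclesOfDim X₀.left d)
    (hf : IsSmoothProjectiveFamily f n) (h𝒳 : IsQuasiProjectiveOver 𝒳) (hS : IsQuasiProjectiveOver S)
    (hSm : _root_.AlgebraicGeometry.Smooth S.hom) [IrreducibleSpace S.left]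
    (hW : ∀ s : ComplexPoints S, IsRationalClass (Res[f, s, 2 * p, W]) ∧
      IsOfHodgeType n (fiberOver f s) (2 * p) p p (Res[f, s, 2 * p, W]))
    (hL : ∀ s : ComplexPoints S, IsRationalClass (Res[f, s, 2 * p, L]) ∧
      IsOfHodgeType n (fiberOver f s) (2 * p) p p (Res[f, s, 2 * p, L]))
    (hLalg : ∀ t : ComplexPoints S, Res[f, t, 2 * p, L] ∈ algebraicClasses (fiberOver f t) p)
    (hx : ((a : ℚ) : ℂ) • complexBetti.map e.hom (2 * p) (Res[f, s₀, 2 * p, W]) +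
        ((b : ℚ) : ℂ) • complexBetti.map e.hom (2 * p) (Res[f, s₀, 2 * p, L]) =
      subschemeClass hX₀ hdp ρ i hi) (t : ComplexPoints S) :
    Res[f, t, 2 * p, W] ∈ algebraicClasses (fiberOver f t) p := by
  obtain ⟨U, hU, hs₀, hUA⟩ := h.of_rat_smul_add X₀ Z i f s₀ e W L a b ha hX₀ d hdp ρ hi hreg hcodim
    hsr hmem hf h𝒳 hS hSm hW hL hLalg hx
  exact hCS.forall_mem_algebraicClasses_of_isOpen f n p h𝒳 hS hSm hf W hU ⟨s₀, hs₀⟩ hUA t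

end Global

end Literature.AlgebraicGeometry.HodgeTheory

end
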